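import Summits.BirchSwinnertonDyer.BirchSwinnertonDyer.Theorems.SchneiderFreeAdditiveX3AnticycControlAdditiveStubBaseCountTorsOfPT
import Summits.BirchSwinnertonDyer.BirchSwinnertonDyer.Theorems.SchneiderFreeAdditiveX3PoitouTateSelmerDualityHolds
import HarnessLib

/-!
# Crux `AnticycControlAdditiveK` (route `SchneiderFreeAdditiveX3`, item stmt-BirchSwinnertonDyer-19295): the registered stub
# `stub_baseCountTors` (P6-add-tors, skeleton v3-K c0242a50) UNCONDITIONALLY, and the crux modulo Poitou–Tate (a) = PT2 only

Seat `bsd-schneider-door-c4`, gen 18 (cell `bsd-schneider-ideate`).  door-c6 g5's `stub_baseCountTors_of_poitouTate` proved the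
registered signature VERBATIM from `∀ K, poitouTate_selmerStructure_duality K` alone; door-c4 g18's
`PoitouTateReduction.poitouTate_selmerStructure_duality_holds` (Route A of the cell: door-c4 / door-c5 / door-c6, 2026-08-26…28)
proves that hypothesis for every number field.  Hence:

* **`stub_baseCountTors`** — the registered stub, sorry-free, no named-fact hypothesis: at every frame, with the actual exponents
  `g` (`#ker res = p^g`) and `t` (`#ker r_𝔭 = p^t`), `#Sel_𝔭(K, E[p^∞]) = p^a` with
  `a = ord_p #Ш[p^∞] + 2 (ord_p log_ω P − ord_p [E(K) : ℤP]) + ord_p ∏_{w ∣ p} c_w + g − t` (Kolyvagin's theorem is the stub's own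
  displayed antecedent, as registered).
* **`anticycControlAdditiveK_of_sha_tateDual`** — the crux `AnticycControlAdditiveK` itself from the ONE remaining named fact
  `∀ K, poitouTate_sha_tateDual K` (Milne I Thm. 4.10 (a), PT2; door-c6's `anticycControlAdditiveK_of_poitouTate` with PT1 discharged).

HONEST FRAMING: `stub_baseCountTors` is a theorem of the tree (its Kolyvagin antecedent is part of the registered statement); the
crux stays open behind PT2 (`poitouTate_sha_tateDual`, item 20462 — bsd-wall / door-c5 g18's Ш²-readout road) — no case of BSD
is proved; closes rung: none.

## References
* D. Jetchev, C. Skinner, X. Wan, Camb. J. Math. 5 (2017), Prop. 3.2.1, Thm. 3.3.1. [JetchevSkinnerWan2017]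
* J. S. Milne, *Arithmetic Duality Theorems* (2nd ed. 2006), I Thm. 4.10. [MilneADT2006]
* E. H. Brink, Cor. 1. [Brink2007]
-/

noncomputable section

open scoped Classical

open Field NumberField IsDedekindDomain WeierstrassCurve
open Literature.NumberTheory.EllipticCurves Literature.NumberTheory.EllipticCurves.GreenbergSelmer
open Literature.NumberTheory.GaloisRepresentations
open Literature.NumberTheory.GaloisCohomology
open Literature.NumberTheory.EllipticCurves.ModularForms
  Literature.NumberTheory.EllipticCurves.Rank1Residual
  Literature.NumberTheory.EllipticCurves.Rank1Residual.Typed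
  Summit.BirchSwinnertonDyer.Rank1Residual
  Summit.BirchSwinnertonDyer.Rank1Residual.X11b
  Summit.BirchSwinnertonDyer.Rank1Residual.X11b.AcSelmer
  Summit.BirchSwinnertonDyer.Rank1Residual.X11b.LocBridge

set_option linter.dupNamespace false

namespace Summit.BirchSwinnertonDyer.BirchSwinnertonDyer.Theorems.SchneiderFreeAdditiveX3

section StubBaseCountTors

open Summit.BirchSwinnertonDyer.BirchSwinnertonDyer.Theses.SchneiderFreeAdditiveX3
  Summit.BirchSwinnertonDyer.BirchSwinnertonDyer.Theorems.SchneiderFree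
  Summit.BirchSwinnertonDyer.BirchSwinnertonDyer.Theorems.SchneiderFreeControlAtoms
  Summit.BirchSwinnertonDyer.BirchSwinnertonDyer.Theorems.SchneiderFreeAdditiveX3.PoitouTateReduction

/-- **The registered stub `stub_baseCountTors` of crux `AnticycControlAdditiveK` (skeleton v3-K), UNCONDITIONAL** (door-c6 g5's
`stub_baseCountTors_of_poitouTate` with its Poitou–Tate hypothesis discharged by `poitouTate_selmerStructure_duality_holds`).
[cite: JetchevSkinnerWan2017, Prop. 3.2.1 and Thm. 3.3.1 (arXiv:1512.06894 pp. 10–11)][cite: MilneADT2006, Ch. I, Thm. 4.10(b)]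
[cite: Brink2007, Cor. 1] -/
theorem stub_baseCountTors :
    (∀ (N : ℕ) [NeZero N] (W : WeierstrassCurve ℚ) (K : Type) [Field K] [NumberField K],
        Literature.NumberTheory.EllipticCurves.kolyvagin N W K) →
      ∀ (W : WeierstrassCurve ℚ) [W.IsElliptic] [W.IsGloballyMinimal] (p : ℕ) [Fact p.Prime],
      W.analyticRank = 1 → p ≠ 2 → ClassX3 W p → Additive.SubSemistableTwist W p →
      ∀ (N : ℕ) [NeZero N] (K : Type) [Field K] [NumberField K]
        (Dt : ModularParametrizationData W N) (H : HeegnerDatum N (NumberField.discr K)) (ι : K →+* ℂ)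
        (P : (W.baseChange K).toAffine.Point),
        W.analyticRank = 1 → Additive.N10.Locus W p → W.conductorNorm ℤ = N →
        ∀ hK : IsImaginaryQuadratic K,
        Odd (NumberField.discr K) → ¬ p ∣ Units.torsionOrder K → SatisfiesHeegnerHypothesis N K →
        (W.quadraticTwist (NumberField.discr K : ℚ)).entireLFunction 1 ≠ 0 →
        WeierstrassCurve.Affine.Point.map ι.toRatAlgHom P = heegnerPointComplex Dt H →
        ¬ IsOfFinAddOrder P →
        ∀ (κ : ZpExtension K p), κ.IsAnticyclotomic →
          ∀ (γ : Field.absoluteGaloisGroup K) [Fact (κ.IsTopGenerator γ)]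
            (𝔭 : HeightOneSpectrum (𝓞 K)) (h𝔭 : ((p : ℕ) : 𝓞 K) ∈ 𝔭.asIdeal)
            (he : 𝔭.asIdeal.ramificationIdx (𝓞 ℚ) = 1) (hf : 𝔭.asIdeal.inertiaDeg (𝓞 ℚ) = 1),
            ∀ g t : ℕ, Nat.card ((W.baseChange K).resOfLe p (le_top : κ.kerSubgroup ≤ ⊤)).ker = p ^ g →
            Nat.card (localKer κ.kerSubgroup ((W.baseChange K).geomPrimaryTorsion p) 𝔭) = p ^ t →
            ∃ a : ℕ, ((∃ _ : Finite (selmerAcBase (W.baseChange K) p 𝔭 ∅),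
                  Nat.card (selmerAcBase (W.baseChange K) p 𝔭 ∅) = p ^ a) ∧
                (a : ℤ) = (padicValNat p
                    (Nat.card (AddCommGroup.primaryComponent (W.baseChange K).sha p)) : ℤ) +
                  2 * (X11b.padicLogOrd W p (embAt K p 𝔭 h𝔭 he hf) P -
                    (padicValNat p (AddSubgroup.zmultiples P).index : ℤ)) +
                    padicValNat p (X11b.tamagawaProductAbove W K p) + g - t) :=
  stub_baseCountTors_of_poitouTate fun K _ _ => poitouTate_selmerStructure_duality_holds K

/-- **The crux `AnticycControlAdditiveK` from PT2 ALONE** (`∀ K, poitouTate_sha_tateDual K`, Milne I Thm. 4.10 (a)): door-c6's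
`anticycControlAdditiveK_of_poitouTate` with Poitou–Tate (b) for Selmer structures discharged.  CONDITIONAL on the named fact
`poitouTate_sha_tateDual` (item 20462); closes nothing by itself. [cite: MilneADT2006, Ch. I, Thm. 4.10][cite: JetchevSkinnerWan2017, Thm. 3.3.1] -/
theorem anticycControlAdditiveK_of_sha_tateDual
    (hPT2 : ∀ (K : Type) [Field K] [NumberField K], poitouTate_sha_tateDual K) :
    AnticycControlAdditiveK :=
  anticycControlAdditiveK_of_poitouTate (fun K _ _ => poitouTate_selmerStructure_duality_holds K) hPT2

end StubBaseCountTors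

end Summit.BirchSwinnertonDyer.BirchSwinnertonDyer.Theorems.SchneiderFreeAdditiveX3

end
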